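import Summits.BirchSwinnertonDyer.BirchSwinnertonDyer.Theorems.CMKolyvaginAtInertTwoKolyvaginPrimeInertAtTwo
import Literature.NumberTheory.EllipticCurves.SelmerTorsionRestriction
import HarnessLib

/-!
# Route `CMKolyvaginAtInertTwo`, crux `CMKolyvaginExactAtInertTwo` (stmt-BirchSwinnertonDyer-24277):
# THE OVER-`ℚ` BIT — the `τ`-INVARIANT half of `Sel₂(E/K)` is bounded by Poitou–Tate OVER `ℚ`,
# and the `M₀ = 0` case of the crux (`y_K ∉ 2E(K) ⟹ Sel₂(E/K) = {0, δ₂ y_K}`) modulo over-`ℚ` inputs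

Seat `bsd-line-cmk2-p1` g8 (cell `bsd-print-cf2`); helper (`--supports stmt-BirchSwinnertonDyer-24277`).
THEOREMS ONLY: no definition, no named fact, no `sorry`; no item is closed; BSD is not proved by this.

WHY. After g6/g7 (KERNEL-STATUS-p2-port.md v6) the Heegner Euler system at `p = 2` gives, OVER `K`,
`c_* = 1` on `Sel₂(E/K)` (`KolyvaginDescentTwo.conjAct_eq_self_of_cmInert_families_two`, p609668)
but no bound on the `τ`-invariant classes: at a Kolyvagin prime `ℓ` (inert in `K`, `Frob_ℓ = τ` a
transposition on `E[2]` with fixed line `⟨T⟩`) every `τ`-invariant Selmer class and every tame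
Kolyvagin vector lie on `⟨T⟩ ⊂ E[2] = H¹_ur(K_λ, E[2])`, and `e₂(T, T) = 0`. THIS IS AN ARTIFACT OF
`K_λ`: the restriction of a class `ξ ∈ H¹(ℚ_ℓ, E[2])` pairs over `K_λ` by `2 · inv_ℓ = 0`
(`cor ∘ res = [K_λ : ℚ_ℓ]`). Over `ℚ_ℓ` itself `H¹_ur(ℚ_ℓ, E[2]) = E[2]/(Frob_ℓ − 1)E[2] = E[2]/⟨T⟩ ≅ ℤ/2`
pairs PERFECTLY with `H¹(ℚ_ℓ, E[2])/H¹_ur ≅ Hom(I_ℓ, E[2])^{Frob_ℓ} = ⟨T⟩` (local Tate duality: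
`H¹_ur` is its own annihilator and is ONE-dimensional), and:
* every `τ`-invariant class of `H¹(K, E[2])` — every Selmer class when `y_K ∉ 2E(K)`, and every mod-`2`
  Kolyvagin class `c(ℓ)` (Gross Prop. 5.4 (2): `τ c(ℓ) = ε_ℓ c(ℓ) = c(ℓ)` mod `2`) — is `res ξ` for a unique
  `ξ ∈ H¹(ℚ, E[2])` (inflation–restriction, `E(K)[2] = 0`);
* for the descended classes the Selmer conditions over `ℚ` and over `K` AGREE at every place of `ℚ`
  except at the primes `q ∣ d_K` (split `v`: `K_w = ℚ_v`; inert good `v`, including `v = 2 ∤ N`: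
  `H¹(K_w/ℚ_v, E(K_w)) = 0` for unramified `K_w/ℚ_v` and good reduction; `v = ∞`: `H¹(ℝ, E[2]) = 0` as
  `Δ_E < 0`); at a ramified `q ∣ d_K` (odd, good) the obstruction group is
  `H¹(K_w/ℚ_q, E(K_w))[2] ≅ Ẽ(𝔽_q)[2] = E(ℚ_q)[2] =: Φ_q` (Kramer's local norm index `i_q = dim Φ_q`);
* Poitou–Tate OVER `ℚ` for `(ξ, κ_ℓ)` (`κ_ℓ` the descent of `c(ℓ)`, Selmer off `{ℓ} ∪ {q ∣ d_K}`), with `ξ`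
  STRICT at the `q ∣ d_K`, reads `inv_ℓ(ξ_ℓ ∪ κ_{ℓ,ℓ}) = 0`, whence `ξ_ℓ = 0` as soon as `κ_ℓ` is ramified
  at `ℓ` (⟸ `y_K ∉ 2E(K_λ)`, Gross Prop. 6.2 (2)) — THE SECOND BIT, invisible over `K`;
* for `d_K = −q` PRIME the relaxed-at-`q` group `S^♯ ⊇ res⁻¹ Sel₂(E/K)` and its strict-at-`q` subgroup
  `S_♭` satisfy `#S^♯ = #Φ_q · #S_♭` (one-place Poitou–Tate count, Greenberg–Wiles), and `#Φ_q = 2` on the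
  items' habitat (Kramer–Monsky parity with `w(E) w(E^K) = −1` forces `q` inert in `ℚ(√Δ_E)`, i.e.
  `Frob_q` a transposition on `E[2]`).
So (this file): Čebotarev at `2` for `τ`-invariant classes (g3, p597930) + the over-`ℚ` reciprocity ⟹
`S_♭ = 0` ⟹ `S^♯ = {0, x}` (`x` the descent of `δ₂ y_K`) ⟹ with g6's `τ`-descent:
**`Sel₂(E/K) = {0, δ₂ y_K}`, i.e. `Ш(E/K)[2] = 0`: the case `M₀ = 0` of the crux** (`#Ш(E/K)[2^∞] = 4⁰`),
for `K = ℚ(√−q)`, `q` prime, modulo the over-`ℚ` inputs listed as binders (all standard: Poitou–Tate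
over `ℚ`, local Tate duality at `ℓ` and `q`, inflation–restriction, Gross §6 at `p = 2`) and the
Kolyvagin-system data at `(2, 1)` over `K` (ty2, p601266) used by g6. What remains for `M₀ ≥ 1` is
McCallum §5 OVER `ℚ` for `E` and `E^K` with the one-bit correction at `q` at every level `2^M` (the
sibling route `GenusKolyvaginAtTwo`'s S7/S8 programme: `KolyvaginDescent.SplitHypothesesM`, p622894).

* §1 `eq_zero_or_eq_of_ratDescent` — the pure algebra: relaxed group `Sel`, strict condition `Aq` at the
  exceptional place, Kolyvagin data `(A i, Loc i, c i)`, four hypotheses (ramification of `c i` from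
  `x ∉ A i`; reciprocity for strict classes; Čebotarev for pairs; the index-`2` count at `q`) ⟹
  `Sel ⊆ {0, x}`; `inf_eq_bot_of_ratDescent` (`S_♭ = 0` from the first three) and
  `natCard_le_of_ratDescent_of_count` (`#S^♯ ≤ #Φ_q` from any one-place count; when `Frob_q = 1` on
  `E[2]`, `#Φ_q = 4`, the bound `#Sel₂(E/K) ≤ 4` and the square order of `Ш(E/K)[2]` finish — not here).
* §2 `eq_zero_or_eq_of_ratDescent_rat` — the same in the currency of `H¹(ℚ, E[n])`
  (`galH1Torsion W n`, local kernels `selmerLocalKer` / `torsionLocalKer` at `v.adicCompletion ℚ`).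
* §3 `selmer_two_eq_zero_or_eq_kummer_of_ratDescent` — `K`-currency: `τ = 1` on `Sel₂(E/K)` + descent
  binder + §2 ⟹ `Sel₂(E/K) ⊆ {0, δ₂ P}`; and ON THE HABITAT H₂ (`HasCM`, `CMInert W 2`, `ρ̄₂` onto,
  Heegner `K`, `P ∉ 2E(K)`, ty2's CM-inert-supported data) `selmer_two_eq_zero_or_eq_kummer_of_cmInert`,
  where `τ = 1` is g6's theorem.

References: [GrossLMS1991] §§5–6 (Props. 5.4, 6.2), §§8–10; [McCallumLMS1991] §2 Prop. 2.2, §3 (3),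
§5 Lemma 5.3; [MilneADT2006] I Cor. 2.3, Thm. 2.6, I.3.8, Thm. 4.10; [Kramer1981] Thm. 1, Prop. 3
(local norm indices); [Kolyvagin1989Izv] §3 (the descent over `ℚ` at `l = 2`).
-/

-- single-conjunct summit: `Summit.BirchSwinnertonDyer.BirchSwinnertonDyer.…` repeats the name by design
set_option linter.dupNamespace false
set_option autoImplicit false

noncomputable section

open scoped Classical
open WeierstrassCurve NumberField IsDedekindDomain Field
open Literature.NumberTheory.GaloisRepresentations Literature.NumberTheory.EllipticCurves

namespace Summit.BirchSwinnertonDyer.BirchSwinnertonDyer.Theorems.KolyvaginRatDescentTwo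

/-! ## §1 The over-`ℚ` bit as pure algebra: a relaxed Selmer group with one exceptional place -/

section Abstract

variable {V : Type*} [AddCommGroup V] {ι : Type*} {Sel Aq : AddSubgroup V} {Kol : ι → Prop}
  {A Loc : ι → AddSubgroup V} {c : ι → V} {x : V}

/-- **Strict classes vanish.** `V = H¹(ℚ, E[2])`, `Sel` = classes Selmer at all places `≠ q`, `Aq` =
"`s_q = 0`", Kolyvagin data `i` (a Kolyvagin prime `ℓ` with its place): `A i` = "`s_ℓ = 0`", `Loc i` =
the Selmer condition at `ℓ`, `c i` = the descended Kolyvagin class `κ_ℓ`; `x ≠ 0` in `Sel` (the descent of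
`δ₂ y_K`). IF (ram) `x_ℓ ≠ 0 ⟹ κ_ℓ` not Selmer at `ℓ` (Gross Prop. 6.2 (2)); (dual) `κ_ℓ` not Selmer at
`ℓ` ⟹ every `s ∈ Sel` strict at `q` has `s_ℓ = 0` (Poitou–Tate over `ℚ` + local duality at `ℓ`); (ceb)
two non-zero classes of `Sel` are simultaneously non-zero at some Kolyvagin `ℓ` (McCallum Cor. 3.2 at
`2`), THEN `Sel ∩ Aq = 0`. [cite: GrossLMS1991, §10 (Claim 10.1) and Prop. 6.2 (2)]
[cite: McCallumLMS1991, §2 Prop. 2.2, §3 Cor. 3.2, §5 Lemma 5.3] -/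
theorem eq_zero_of_ratDescent_strict (hx0 : x ≠ 0) (hx : x ∈ Sel)
    (hram : ∀ i, Kol i → x ∉ A i → c i ∉ Loc i)
    (hdual : ∀ i, Kol i → c i ∉ Loc i → ∀ s ∈ Sel, s ∈ Aq → s ∈ A i)
    (hceb : ∀ s₁ ∈ Sel, ∀ s₂ ∈ Sel, s₁ ≠ 0 → s₂ ≠ 0 → ∃ i, Kol i ∧ s₁ ∉ A i ∧ s₂ ∉ A i)
    {s : V} (hs : s ∈ Sel) (hsq : s ∈ Aq) : s = 0 := by
  by_contra hs0
  obtain ⟨i, hi, hsA, hxA⟩ := hceb s hs x hx hs0 hx0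
  exact hsA (hdual i hi (hram i hi hxA) s hs hsq)

/-- **Strict part trivial, subgroup form: `Sel ⊓ Aq = ⊥`** under the hypotheses of
`eq_zero_of_ratDescent_strict`. With the one-place Poitou–Tate count `#Sel ≤ #Φ_q · #(Sel ⊓ Aq)`
(`Φ_q = E(ℚ_q)[2]`, of order `2` or `4` on the habitat — order `1` is excluded by Kramer–Monsky parity)
this bounds `#Sel ≤ #Φ_q` (`natCard_le_of_ratDescent_of_count`); for `#Φ_q = 2` see
`eq_zero_or_eq_of_ratDescent`, for `#Φ_q = 4` the square order of `Ш(E/K)[2]` (Cassels–Tate) finishes.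
[cite: GrossLMS1991, §10 (Claim 10.1)] [cite: MilneADT2006, Ch. I, Thm. 4.10] -/
theorem inf_eq_bot_of_ratDescent (hx0 : x ≠ 0) (hx : x ∈ Sel)
    (hram : ∀ i, Kol i → x ∉ A i → c i ∉ Loc i)
    (hdual : ∀ i, Kol i → c i ∉ Loc i → ∀ s ∈ Sel, s ∈ Aq → s ∈ A i)
    (hceb : ∀ s₁ ∈ Sel, ∀ s₂ ∈ Sel, s₁ ≠ 0 → s₂ ≠ 0 → ∃ i, Kol i ∧ s₁ ∉ A i ∧ s₂ ∉ A i) :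
    Sel ⊓ Aq = ⊥ := by
  rw [eq_bot_iff]
  intro s hs
  rw [AddSubgroup.mem_bot]
  exact eq_zero_of_ratDescent_strict hx0 hx hram hdual hceb (AddSubgroup.mem_inf.mp hs).1
    (AddSubgroup.mem_inf.mp hs).2

/-- **`#Sel ≤ #Φ_q` from the one-place count** `#Sel ≤ m · #(Sel ⊓ Aq)` (Poitou–Tate at the single
place `q`, `m = #E(ℚ_q)[2]`) and `Sel ⊓ Aq = ⊥`. [cite: MilneADT2006, Ch. I, Thm. 4.10] -/
theorem natCard_le_of_ratDescent_of_count (hx0 : x ≠ 0) (hx : x ∈ Sel)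
    (hram : ∀ i, Kol i → x ∉ A i → c i ∉ Loc i)
    (hdual : ∀ i, Kol i → c i ∉ Loc i → ∀ s ∈ Sel, s ∈ Aq → s ∈ A i)
    (hceb : ∀ s₁ ∈ Sel, ∀ s₂ ∈ Sel, s₁ ≠ 0 → s₂ ≠ 0 → ∃ i, Kol i ∧ s₁ ∉ A i ∧ s₂ ∉ A i)
    {m : ℕ} (hcount : Nat.card Sel ≤ m * Nat.card ↥(Sel ⊓ Aq)) : Nat.card Sel ≤ m := by
  rw [inf_eq_bot_of_ratDescent hx0 hx hram hdual hceb, AddSubgroup.card_bot, mul_one] at hcount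
  exact hcount

/-- **The over-`ℚ` descent, `M₀ = 0`: `Sel ⊆ {0, x}`.** With the hypotheses of
`eq_zero_of_ratDescent_strict` and (lag) "two classes of `Sel` NOT strict at `q` differ by a strict one"
(the one-place Poitou–Tate count `#S^♯ = #Φ_q · #S_♭` with `#Φ_q = #E(ℚ_q)[2] = 2`), every class of `Sel` is
`0` or `x`. [cite: GrossLMS1991, §10 (Claims 10.1, 10.3)] [cite: MilneADT2006, Ch. I, Thm. 4.10] -/
theorem eq_zero_or_eq_of_ratDescent (hx0 : x ≠ 0) (hx : x ∈ Sel)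
    (hram : ∀ i, Kol i → x ∉ A i → c i ∉ Loc i)
    (hdual : ∀ i, Kol i → c i ∉ Loc i → ∀ s ∈ Sel, s ∈ Aq → s ∈ A i)
    (hceb : ∀ s₁ ∈ Sel, ∀ s₂ ∈ Sel, s₁ ≠ 0 → s₂ ≠ 0 → ∃ i, Kol i ∧ s₁ ∉ A i ∧ s₂ ∉ A i)
    (hlag : ∀ s₁ ∈ Sel, ∀ s₂ ∈ Sel, s₁ ∉ Aq → s₂ ∉ Aq → s₁ - s₂ ∈ Aq) :
    ∀ s ∈ Sel, s = 0 ∨ s = x := by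
  intro s hs
  by_cases hsq : s ∈ Aq
  · exact Or.inl (eq_zero_of_ratDescent_strict hx0 hx hram hdual hceb hs hsq)
  · right
    have hxq : x ∉ Aq := fun h ↦ hx0 (eq_zero_of_ratDescent_strict hx0 hx hram hdual hceb hx h)
    exact sub_eq_zero.mp (eq_zero_of_ratDescent_strict hx0 hx hram hdual hceb (Sel.sub_mem hs hx)
      (hlag s hs x hx hsq hxq))

/-- **Cardinality form: `#Sel ≤ 2`** under the hypotheses of `eq_zero_or_eq_of_ratDescent`.
[cite: GrossLMS1991, §10 (Claims 10.1, 10.3)] -/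
theorem natCard_le_two_of_ratDescent (hx0 : x ≠ 0) (hx : x ∈ Sel)
    (hram : ∀ i, Kol i → x ∉ A i → c i ∉ Loc i)
    (hdual : ∀ i, Kol i → c i ∉ Loc i → ∀ s ∈ Sel, s ∈ Aq → s ∈ A i)
    (hceb : ∀ s₁ ∈ Sel, ∀ s₂ ∈ Sel, s₁ ≠ 0 → s₂ ≠ 0 → ∃ i, Kol i ∧ s₁ ∉ A i ∧ s₂ ∉ A i)
    (hlag : ∀ s₁ ∈ Sel, ∀ s₂ ∈ Sel, s₁ ∉ Aq → s₂ ∉ Aq → s₁ - s₂ ∈ Aq) :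
    Nat.card Sel ≤ 2 := by
  have h := eq_zero_or_eq_of_ratDescent hx0 hx hram hdual hceb hlag
  let f : Sel → Bool := fun s ↦ decide ((s : V) = 0)
  have hf : Function.Injective f := by
    intro a b hab
    apply Subtype.ext
    rcases h a a.2 with ha | ha <;> rcases h b b.2 with hb | hb
    · rw [ha, hb]
    · exfalso
      have : f a = f b := hab
      simp only [f, ha, hb, decide_true, hx0, decide_false] at this
      exact Bool.noConfusion this
    · exfalso
      have : f a = f b := hab
      simp only [f, ha, hb, decide_true, hx0, decide_false] at this
      exact Bool.noConfusion this
    · rw [ha, hb]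
  haveI : Finite Sel := Finite.of_injective f hf
  calc Nat.card Sel ≤ Nat.card Bool := Nat.card_le_card_of_injective f hf
    _ = 2 := by simp

end Abstract

/-! ## §2 The same in the currency of `H¹(ℚ, E[n])` -/

section Rat

variable (W : WeierstrassCurve ℚ) (n : ℤ)

/-- **The over-`ℚ` descent in Galois-cohomological currency.** `W/ℚ`; `u` the exceptional finite place
(the prime `q = −d_K`); a class `s ∈ H¹(ℚ, E[n])` is RELAXED-SELMER if it satisfies the Selmer local
condition (`selmerLocalKer`) at every finite place `v ≠ u` and at the infinite place; it is STRICT at a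
finite place `v` if `s ∈ torsionLocalKer` there (`s_v = 0` in `H¹(ℚ_v, E[n])`). Kolyvagin primes `ℓ`
(`Kol ℓ`) carry classes `c ℓ ∈ H¹(ℚ, E[n])` (the descents of `c(ℓ)`); `x` is a non-zero relaxed-Selmer
class (the descent of `δ_n y_K`). The four binders are the over-`ℚ` inputs of the module docstring:
(hram) Gross Prop. 6.2 (2) read over `ℚ_ℓ`; (hdual) Poitou–Tate over `ℚ` for a strict-at-`u` relaxed
class against `c ℓ`, with local duality at `ℓ` (`H¹_ur(ℚ_ℓ, E[2])` one-dimensional and self-annihilating);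
(hceb) McCallum Cor. 3.2 at `2` for two `τ`-invariant classes (the tree's `exists_kolyvaginPrime_gt_two`
transported along `res`); (hlag) the one-place Poitou–Tate count at `u` with `#E(ℚ_u)[2] = 2`. THEN every
relaxed-Selmer class is `0` or `x`. [cite: GrossLMS1991, §10 and Prop. 6.2 (2)]
[cite: McCallumLMS1991, §2 Prop. 2.2, §3 Cor. 3.2] [cite: MilneADT2006, Ch. I, Thm. 2.6 and Thm. 4.10] -/
theorem eq_zero_or_eq_of_ratDescent_rat (u : HeightOneSpectrum (𝓞 ℚ)) (Kol : ℕ → Prop)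
    (c : ℕ → galH1Torsion W n) {x : galH1Torsion W n} (hx0 : x ≠ 0)
    (hxS : (∀ v : HeightOneSpectrum (𝓞 ℚ), v ≠ u → x ∈ selmerLocalKer W (v.adicCompletion ℚ) n) ∧
      ∀ w : InfinitePlace ℚ, x ∈ selmerLocalKer W w.Completion n)
    (hram : ∀ ℓ, Kol ℓ → ∀ v : HeightOneSpectrum (𝓞 ℚ), (ℓ : 𝓞 ℚ) ∈ v.asIdeal →
      x ∉ W.torsionLocalKer (v.adicCompletion ℚ) n → c ℓ ∉ selmerLocalKer W (v.adicCompletion ℚ) n)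
    (hdual : ∀ ℓ, Kol ℓ → ∀ v : HeightOneSpectrum (𝓞 ℚ), (ℓ : 𝓞 ℚ) ∈ v.asIdeal →
      c ℓ ∉ selmerLocalKer W (v.adicCompletion ℚ) n → ∀ s : galH1Torsion W n,
      (∀ v' : HeightOneSpectrum (𝓞 ℚ), v' ≠ u → s ∈ selmerLocalKer W (v'.adicCompletion ℚ) n) →
      (∀ w : InfinitePlace ℚ, s ∈ selmerLocalKer W w.Completion n) →
      s ∈ W.torsionLocalKer (u.adicCompletion ℚ) n → s ∈ W.torsionLocalKer (v.adicCompletion ℚ) n)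
    (hceb : ∀ s₁ s₂ : galH1Torsion W n,
      (∀ v : HeightOneSpectrum (𝓞 ℚ), v ≠ u → s₁ ∈ selmerLocalKer W (v.adicCompletion ℚ) n) →
      (∀ w : InfinitePlace ℚ, s₁ ∈ selmerLocalKer W w.Completion n) →
      (∀ v : HeightOneSpectrum (𝓞 ℚ), v ≠ u → s₂ ∈ selmerLocalKer W (v.adicCompletion ℚ) n) →
      (∀ w : InfinitePlace ℚ, s₂ ∈ selmerLocalKer W w.Completion n) → s₁ ≠ 0 → s₂ ≠ 0 →
      ∃ ℓ, Kol ℓ ∧ ∃ v : HeightOneSpectrum (𝓞 ℚ), (ℓ : 𝓞 ℚ) ∈ v.asIdeal ∧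
        s₁ ∉ W.torsionLocalKer (v.adicCompletion ℚ) n ∧ s₂ ∉ W.torsionLocalKer (v.adicCompletion ℚ) n)
    (hlag : ∀ s₁ s₂ : galH1Torsion W n,
      (∀ v : HeightOneSpectrum (𝓞 ℚ), v ≠ u → s₁ ∈ selmerLocalKer W (v.adicCompletion ℚ) n) →
      (∀ w : InfinitePlace ℚ, s₁ ∈ selmerLocalKer W w.Completion n) →
      (∀ v : HeightOneSpectrum (𝓞 ℚ), v ≠ u → s₂ ∈ selmerLocalKer W (v.adicCompletion ℚ) n) →
      (∀ w : InfinitePlace ℚ, s₂ ∈ selmerLocalKer W w.Completion n) →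
      s₁ ∉ W.torsionLocalKer (u.adicCompletion ℚ) n → s₂ ∉ W.torsionLocalKer (u.adicCompletion ℚ) n →
      s₁ - s₂ ∈ W.torsionLocalKer (u.adicCompletion ℚ) n) :
    ∀ s : galH1Torsion W n,
      (∀ v : HeightOneSpectrum (𝓞 ℚ), v ≠ u → s ∈ selmerLocalKer W (v.adicCompletion ℚ) n) →
      (∀ w : InfinitePlace ℚ, s ∈ selmerLocalKer W w.Completion n) → s = 0 ∨ s = x := by
  -- the relaxed Selmer group as a subgroup
  let Sel : AddSubgroup (galH1Torsion W n) :=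
    (⨅ (v : HeightOneSpectrum (𝓞 ℚ)) (_ : v ≠ u), selmerLocalKer W (v.adicCompletion ℚ) n) ⊓
      ⨅ w : InfinitePlace ℚ, selmerLocalKer W w.Completion n
  have hSel : ∀ s, s ∈ Sel ↔
      (∀ v : HeightOneSpectrum (𝓞 ℚ), v ≠ u → s ∈ selmerLocalKer W (v.adicCompletion ℚ) n) ∧
        ∀ w : InfinitePlace ℚ, s ∈ selmerLocalKer W w.Completion n := fun s ↦ by
    simp only [Sel, AddSubgroup.mem_inf, AddSubgroup.mem_iInf]
  -- Kolyvagin data indexed by (prime, place)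
  let ιK := ℕ × HeightOneSpectrum (𝓞 ℚ)
  let KolD : ιK → Prop := fun i ↦ Kol i.1 ∧ (i.1 : 𝓞 ℚ) ∈ i.2.asIdeal
  let AD : ιK → AddSubgroup (galH1Torsion W n) := fun i ↦ W.torsionLocalKer (i.2.adicCompletion ℚ) n
  let LocD : ιK → AddSubgroup (galH1Torsion W n) := fun i ↦ selmerLocalKer W (i.2.adicCompletion ℚ) n
  let cD : ιK → galH1Torsion W n := fun i ↦ c i.1
  have key := eq_zero_or_eq_of_ratDescent (Sel := Sel) (Aq := W.torsionLocalKer (u.adicCompletion ℚ) n)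
    (Kol := KolD) (A := AD) (Loc := LocD) (c := cD) (x := x) hx0 ((hSel x).mpr hxS)
    (fun i hi hxi ↦ hram i.1 hi.1 i.2 hi.2 hxi)
    (fun i hi hci s hs hsq ↦ hdual i.1 hi.1 i.2 hi.2 hci s ((hSel s).mp hs).1 ((hSel s).mp hs).2 hsq)
    (fun s₁ hs₁ s₂ hs₂ h₁ h₂ ↦ by
      obtain ⟨ℓ, hℓ, v, hv, h₁', h₂'⟩ := hceb s₁ s₂ ((hSel s₁).mp hs₁).1 ((hSel s₁).mp hs₁).2
        ((hSel s₂).mp hs₂).1 ((hSel s₂).mp hs₂).2 h₁ h₂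
      exact ⟨(ℓ, v), ⟨hℓ, hv⟩, h₁', h₂'⟩)
    (fun s₁ hs₁ s₂ hs₂ h₁ h₂ ↦ hlag s₁ s₂ ((hSel s₁).mp hs₁).1 ((hSel s₁).mp hs₁).2
      ((hSel s₂).mp hs₂).1 ((hSel s₂).mp hs₂).2 h₁ h₂)
  intro s hs hs'
  exact key s ((hSel s).mpr ⟨hs, hs'⟩)

end Rat

/-! ## §3 `K`-currency: `Sel_n(E/K) ⊆ {0, δ_n P}` from `τ = 1`, the descent binder and §2 -/

section OverK

variable (W : WeierstrassCurve ℚ) {K : Type} [Field K] [NumberField K]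

/-- **`Sel_n(E/K) ⊆ {0, δ_n P}` from the over-`ℚ` descent.** `W/ℚ`, `K` a number field with an
automorphism `c`, `P ∈ E(K)` with `δ_n P ≠ 0`; IF `c_* = 1` on `Sel_n(E/K)` (at `n = 2` on the habitat:
g6's `τ`-part descent), every `c_*`-invariant Selmer class is the restriction of a relaxed-Selmer class of
`H¹(ℚ, E[n])` (hdesc: inflation–restriction with `E(K)[2] = 0`, and agreement of the local conditions at
every place of `ℚ` except the exceptional one `u`), and the four over-`ℚ` binders of
`eq_zero_or_eq_of_ratDescent_rat` hold (with `x` ANY descent of `δ_n P`), THEN every class of `Sel_n(E/K)`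
is `0` or `δ_n P`. [cite: GrossLMS1991, §5 (5.1), §10, Prop. 6.2 (2)]
[cite: McCallumLMS1991, §2 Prop. 2.2, §3 (3) and Cor. 3.2] [cite: MilneADT2006, Ch. I, Thm. 4.10] -/
theorem selmer_eq_zero_or_eq_kummer_of_ratDescent {n : ℤ}
    (hdiv : ∀ Q : geomPoints (W.baseChange K), ∃ R, n • R = Q) (P : (W.baseChange K).toAffine.Point)
    (hP0 : kummerMapTorsion (W.baseChange K) n hdiv P ≠ 0) {c : K ≃ₐ[ℚ] K}
    (hτ : ∀ s ∈ selmerGroup (W.baseChange K) n, conjAct W c n s = s)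
    (u : HeightOneSpectrum (𝓞 ℚ)) (Kol : ℕ → Prop) (cQ : ℕ → galH1Torsion W n)
    (hdesc : ∀ s ∈ selmerGroup (W.baseChange K) n, conjAct W c n s = s →
      ∃ ξ : galH1Torsion W n,
        (∀ v : HeightOneSpectrum (𝓞 ℚ), v ≠ u → ξ ∈ selmerLocalKer W (v.adicCompletion ℚ) n) ∧
        (∀ w : InfinitePlace ℚ, ξ ∈ selmerLocalKer W w.Completion n) ∧ resTorsion W K n ξ = s)
    (hram : ∀ ℓ, Kol ℓ → ∀ v : HeightOneSpectrum (𝓞 ℚ), (ℓ : 𝓞 ℚ) ∈ v.asIdeal →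
      ∀ ξ : galH1Torsion W n, resTorsion W K n ξ = kummerMapTorsion (W.baseChange K) n hdiv P →
      ξ ∉ W.torsionLocalKer (v.adicCompletion ℚ) n → cQ ℓ ∉ selmerLocalKer W (v.adicCompletion ℚ) n)
    (hdual : ∀ ℓ, Kol ℓ → ∀ v : HeightOneSpectrum (𝓞 ℚ), (ℓ : 𝓞 ℚ) ∈ v.asIdeal →
      cQ ℓ ∉ selmerLocalKer W (v.adicCompletion ℚ) n → ∀ s : galH1Torsion W n,
      (∀ v' : HeightOneSpectrum (𝓞 ℚ), v' ≠ u → s ∈ selmerLocalKer W (v'.adicCompletion ℚ) n) →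
      (∀ w : InfinitePlace ℚ, s ∈ selmerLocalKer W w.Completion n) →
      s ∈ W.torsionLocalKer (u.adicCompletion ℚ) n → s ∈ W.torsionLocalKer (v.adicCompletion ℚ) n)
    (hceb : ∀ s₁ s₂ : galH1Torsion W n,
      (∀ v : HeightOneSpectrum (𝓞 ℚ), v ≠ u → s₁ ∈ selmerLocalKer W (v.adicCompletion ℚ) n) →
      (∀ w : InfinitePlace ℚ, s₁ ∈ selmerLocalKer W w.Completion n) →
      (∀ v : HeightOneSpectrum (𝓞 ℚ), v ≠ u → s₂ ∈ selmerLocalKer W (v.adicCompletion ℚ) n) →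
      (∀ w : InfinitePlace ℚ, s₂ ∈ selmerLocalKer W w.Completion n) → s₁ ≠ 0 → s₂ ≠ 0 →
      ∃ ℓ, Kol ℓ ∧ ∃ v : HeightOneSpectrum (𝓞 ℚ), (ℓ : 𝓞 ℚ) ∈ v.asIdeal ∧
        s₁ ∉ W.torsionLocalKer (v.adicCompletion ℚ) n ∧ s₂ ∉ W.torsionLocalKer (v.adicCompletion ℚ) n)
    (hlag : ∀ s₁ s₂ : galH1Torsion W n,
      (∀ v : HeightOneSpectrum (𝓞 ℚ), v ≠ u → s₁ ∈ selmerLocalKer W (v.adicCompletion ℚ) n) →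
      (∀ w : InfinitePlace ℚ, s₁ ∈ selmerLocalKer W w.Completion n) →
      (∀ v : HeightOneSpectrum (𝓞 ℚ), v ≠ u → s₂ ∈ selmerLocalKer W (v.adicCompletion ℚ) n) →
      (∀ w : InfinitePlace ℚ, s₂ ∈ selmerLocalKer W w.Completion n) →
      s₁ ∉ W.torsionLocalKer (u.adicCompletion ℚ) n → s₂ ∉ W.torsionLocalKer (u.adicCompletion ℚ) n →
      s₁ - s₂ ∈ W.torsionLocalKer (u.adicCompletion ℚ) n) :
    ∀ s ∈ selmerGroup (W.baseChange K) n,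
      s = 0 ∨ s = kummerMapTorsion (W.baseChange K) n hdiv P := by
  -- the Kummer class of `P` is Selmer and `c_*`-invariant, hence descends: this is `x`
  have hPS : kummerMapTorsion (W.baseChange K) n hdiv P ∈ selmerGroup (W.baseChange K) n :=
    (mem_selmerGroup_iff (W.baseChange K) n _).mpr
      ⟨fun v ↦ kummerMapTorsion_mem_selmerLocalKer (W.baseChange K) n hdiv (v.adicCompletion K) P,
        fun w ↦ kummerMapTorsion_mem_selmerLocalKer (W.baseChange K) n hdiv w.Completion P⟩
  obtain ⟨x, hx₁, hx₂, hx₃⟩ := hdesc _ hPS (hτ _ hPS)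
  have hx0 : x ≠ 0 := by
    rintro rfl
    exact hP0 (by rw [← hx₃, map_zero])
  have key := eq_zero_or_eq_of_ratDescent_rat W n u Kol cQ hx0 ⟨hx₁, hx₂⟩
    (fun ℓ hℓ v hv hxv ↦ hram ℓ hℓ v hv x hx₃ hxv) hdual hceb hlag
  intro s hs
  obtain ⟨ξ, hξ₁, hξ₂, hξ₃⟩ := hdesc s hs (hτ s hs)
  rcases key ξ hξ₁ hξ₂ with h | h
  · left; rw [← hξ₃, h, map_zero]
  · right; rw [← hξ₃, h, hx₃]

/-- **ON THE HABITAT H₂ — the case `M₀ = 0` of the crux modulo the over-`ℚ` inputs: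
`Sel₂(E/K) ⊆ {0, δ₂ y_K}`** for `E/ℚ` with `HasCM`, `2` inert in `F = Frac End E`, `ρ̄_{E,2}` onto,
`K` imaginary quadratic with the Heegner hypothesis for `N_E`, conjugation `c ≠ 1`, `P = y_K ∈ E(K)` a
Heegner point of level `N_E` with `P ∉ 2E(K)` (`M₀ = 0`), GIVEN ty2's CM-inert-supported Kolyvagin-system
data at `p = 2` (`PointSystemFamily` / `ReciprocityFamily`, p601266 — they give `c_* = 1` on `Sel₂(E/K)` by
g6's `conjAct_eq_self_of_cmInert_families_two`) AND the over-`ℚ` binders of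
`selmer_eq_zero_or_eq_kummer_of_ratDescent` (descent, Gross Prop. 6.2 (2) over `ℚ_ℓ`, Poitou–Tate over `ℚ`
with local duality at `ℓ`, McCallum Cor. 3.2 at `2` for pairs, the one-place count at `u = (q)`,
`d_K = −q`). Consequently `E(K)/2E(K) = ⟨y_K⟩` and `Ш(E/K)[2] = 0` (Kummer sequence), i.e.
`#Ш(E/K)[2^∞] = 1 = 4^{M₀}`. [cite: GrossLMS1991, Prop. 2.1 with §10, Props. 5.4, 6.2]
[cite: McCallumLMS1991, §2 Prop. 2.2, §3 Cor. 3.2, §5 Lemma 5.3] [cite: Kolyvagin1989Izv, §3] -/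
theorem selmer_two_eq_zero_or_eq_kummer_of_cmInert [W.IsElliptic] [W.IsGloballyMinimal]
    [NeZero (W.conductorNorm ℤ)] (hCM : W.HasCM)
    (hin : Literature.NumberTheory.EllipticCurves.Rank1Residual.CMInert W 2)
    (hsurj : W.HasSurjectiveModNGaloisRep 2) (hK : IsImaginaryQuadratic K)
    (hH : SatisfiesHeegnerHypothesis (W.conductorNorm ℤ) K)
    {P : (W.baseChange K).toAffine.Point} (hP : IsHeegnerPoint (W.conductorNorm ℤ) W K P)
    {c : K ≃ₐ[ℚ] K} (hc : c ≠ 1) (hy : ∀ Q : (W.baseChange K).toAffine.Point, 2 • Q ≠ P)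
    (D : Rank1Residual.P2.KolyvaginMachine.PointSystemFamily (W.conductorNorm ℤ) W K P 2
      (Literature.NumberTheory.EllipticCurves.Rank1Residual.CMInert W))
    (R : Rank1Residual.P2.KolyvaginMachine.ReciprocityFamily (W.conductorNorm ℤ) W K 2
      (Literature.NumberTheory.EllipticCurves.Rank1Residual.CMInert W))
    (hdiv : ∀ Q : geomPoints (W.baseChange K), ∃ R, ((2 ^ 1 : ℕ) : ℤ) • R = Q)
    (u : HeightOneSpectrum (𝓞 ℚ)) (Kol : ℕ → Prop) (cQ : ℕ → galH1Torsion W ((2 ^ 1 : ℕ) : ℤ))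
    (hdesc : ∀ s ∈ selmerGroup (W.baseChange K) ((2 ^ 1 : ℕ) : ℤ),
      conjAct W c ((2 ^ 1 : ℕ) : ℤ) s = s → ∃ ξ : galH1Torsion W ((2 ^ 1 : ℕ) : ℤ),
        (∀ v : HeightOneSpectrum (𝓞 ℚ), v ≠ u →
          ξ ∈ selmerLocalKer W (v.adicCompletion ℚ) ((2 ^ 1 : ℕ) : ℤ)) ∧
        (∀ w : InfinitePlace ℚ, ξ ∈ selmerLocalKer W w.Completion ((2 ^ 1 : ℕ) : ℤ)) ∧
        resTorsion W K ((2 ^ 1 : ℕ) : ℤ) ξ = s)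
    (hram : ∀ ℓ, Kol ℓ → ∀ v : HeightOneSpectrum (𝓞 ℚ), (ℓ : 𝓞 ℚ) ∈ v.asIdeal →
      ∀ ξ : galH1Torsion W ((2 ^ 1 : ℕ) : ℤ), resTorsion W K ((2 ^ 1 : ℕ) : ℤ) ξ =
        kummerMapTorsion (W.baseChange K) ((2 ^ 1 : ℕ) : ℤ) hdiv P →
      ξ ∉ W.torsionLocalKer (v.adicCompletion ℚ) ((2 ^ 1 : ℕ) : ℤ) →
      cQ ℓ ∉ selmerLocalKer W (v.adicCompletion ℚ) ((2 ^ 1 : ℕ) : ℤ))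
    (hdual : ∀ ℓ, Kol ℓ → ∀ v : HeightOneSpectrum (𝓞 ℚ), (ℓ : 𝓞 ℚ) ∈ v.asIdeal →
      cQ ℓ ∉ selmerLocalKer W (v.adicCompletion ℚ) ((2 ^ 1 : ℕ) : ℤ) →
      ∀ s : galH1Torsion W ((2 ^ 1 : ℕ) : ℤ),
      (∀ v' : HeightOneSpectrum (𝓞 ℚ), v' ≠ u →
        s ∈ selmerLocalKer W (v'.adicCompletion ℚ) ((2 ^ 1 : ℕ) : ℤ)) →
      (∀ w : InfinitePlace ℚ, s ∈ selmerLocalKer W w.Completion ((2 ^ 1 : ℕ) : ℤ)) →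
      s ∈ W.torsionLocalKer (u.adicCompletion ℚ) ((2 ^ 1 : ℕ) : ℤ) →
      s ∈ W.torsionLocalKer (v.adicCompletion ℚ) ((2 ^ 1 : ℕ) : ℤ))
    (hceb : ∀ s₁ s₂ : galH1Torsion W ((2 ^ 1 : ℕ) : ℤ),
      (∀ v : HeightOneSpectrum (𝓞 ℚ), v ≠ u →
        s₁ ∈ selmerLocalKer W (v.adicCompletion ℚ) ((2 ^ 1 : ℕ) : ℤ)) →
      (∀ w : InfinitePlace ℚ, s₁ ∈ selmerLocalKer W w.Completion ((2 ^ 1 : ℕ) : ℤ)) →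
      (∀ v : HeightOneSpectrum (𝓞 ℚ), v ≠ u →
        s₂ ∈ selmerLocalKer W (v.adicCompletion ℚ) ((2 ^ 1 : ℕ) : ℤ)) →
      (∀ w : InfinitePlace ℚ, s₂ ∈ selmerLocalKer W w.Completion ((2 ^ 1 : ℕ) : ℤ)) →
      s₁ ≠ 0 → s₂ ≠ 0 →
      ∃ ℓ, Kol ℓ ∧ ∃ v : HeightOneSpectrum (𝓞 ℚ), (ℓ : 𝓞 ℚ) ∈ v.asIdeal ∧
        s₁ ∉ W.torsionLocalKer (v.adicCompletion ℚ) ((2 ^ 1 : ℕ) : ℤ) ∧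
        s₂ ∉ W.torsionLocalKer (v.adicCompletion ℚ) ((2 ^ 1 : ℕ) : ℤ))
    (hlag : ∀ s₁ s₂ : galH1Torsion W ((2 ^ 1 : ℕ) : ℤ),
      (∀ v : HeightOneSpectrum (𝓞 ℚ), v ≠ u →
        s₁ ∈ selmerLocalKer W (v.adicCompletion ℚ) ((2 ^ 1 : ℕ) : ℤ)) →
      (∀ w : InfinitePlace ℚ, s₁ ∈ selmerLocalKer W w.Completion ((2 ^ 1 : ℕ) : ℤ)) →
      (∀ v : HeightOneSpectrum (𝓞 ℚ), v ≠ u →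
        s₂ ∈ selmerLocalKer W (v.adicCompletion ℚ) ((2 ^ 1 : ℕ) : ℤ)) →
      (∀ w : InfinitePlace ℚ, s₂ ∈ selmerLocalKer W w.Completion ((2 ^ 1 : ℕ) : ℤ)) →
      s₁ ∉ W.torsionLocalKer (u.adicCompletion ℚ) ((2 ^ 1 : ℕ) : ℤ) →
      s₂ ∉ W.torsionLocalKer (u.adicCompletion ℚ) ((2 ^ 1 : ℕ) : ℤ) →
      s₁ - s₂ ∈ W.torsionLocalKer (u.adicCompletion ℚ) ((2 ^ 1 : ℕ) : ℤ)) :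
    ∀ s ∈ selmerGroup (W.baseChange K) ((2 ^ 1 : ℕ) : ℤ),
      s = 0 ∨ s = kummerMapTorsion (W.baseChange K) ((2 ^ 1 : ℕ) : ℤ) hdiv P := by
  -- `τ = 1` on `Sel₂(E/K)`: g6's `τ`-part descent on the habitat
  have hτ := KolyvaginDescentTwo.conjAct_eq_self_of_cmInert_families_two W hCM hin hsurj hK hH hP hc
    hy D R
  -- `δ₂ P ≠ 0` since `P ∉ 2E(K)`
  have hP0 : kummerMapTorsion (W.baseChange K) ((2 ^ 1 : ℕ) : ℤ) hdiv P ≠ 0 := by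
    intro h0
    have hker : P ∈ (kummerMapTorsion (W.baseChange K) ((2 ^ 1 : ℕ) : ℤ) hdiv).ker := h0
    rw [kummerMapTorsion_ker, AddMonoidHom.mem_range] at hker
    obtain ⟨Q, hQ⟩ := hker
    refine hy Q ?_
    have hQ' : ((2 ^ 1 : ℕ) : ℤ) • Q = P := hQ
    rwa [pow_one, natCast_zsmul] at hQ'
  exact selmer_eq_zero_or_eq_kummer_of_ratDescent W hdiv P hP0 hτ u Kol cQ hdesc hram hdual hceb hlag

end OverK

end Summit.BirchSwinnertonDyer.BirchSwinnertonDyer.Theorems.KolyvaginRatDescentTwo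

end
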